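import Summits.ValiantsHypothesis.ValiantsHypothesis.Theorems.DivisionGapPerDivisionHardStubTorus

/-!
# Crux `DivisionGap.PerDivisionHard` (stmt-ValiantsHypothesis-5065), line `pair-descent-jss-endpoint` —
stub `stub_localUniqueTop`: a row-local (column-local) polynomial is topped by one monomial

Under the TWO-SCALE DIGIT character `w(i,j) = B^i + B^{n+j}` with radix `B = D + 1`, a monomial
`m` weighs `Σ_i rowMargin_i(m) · B^i + Σ_j colMargin_j(m) · B^{n+j}` (`weight_twoScale`): the
base-`B` numeral whose digit vector, indexed by `Fin (n + n)`, is the row margins followed by the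
column margins.  For a polynomial `f` of total degree `≤ D` every margin of every monomial is
`≤ D < B` (`mapDomain_apply_le_totalDegree`), and all monomials of the top component `top_w f`
have the same (maximal) weight (`coeff_topComponent`), so by base-`B` uniqueness
(`eq_of_sum_mul_pow_eq`) they share the row-margin vector AND the column-margin vector
(`margins_eq_of_mem_support_topComponent_twoScale`).  A monomial living in one row `r` is read
off its column margins (`m (r, j)` is the `j`-th column margin, `apply_eq_mapDomain_snd_of_row`),
a monomial living in one column `s` off its row margins; hence if all monomials of `f` live in
one row (or all in one column), the top component has at most one monomial
(`stub_localUniqueTop`). [folklore]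
-/

noncomputable section

-- `Summit.ValiantsHypothesis.ValiantsHypothesis.…` is the tree's mandated single-conjunct layout
-- (Sub = Summit), so the duplicated namespace component is intended.
set_option linter.dupNamespace false

namespace Summit.ValiantsHypothesis.ValiantsHypothesis.Theorems.DivisionGapPerDivisionHard

open MvPolynomial
open Summit.ValiantsHypothesis.ValiantsHypothesis.Theorems.ZeroOneTransfer.Negative
open scoped NNReal

variable {n : ℕ}

/-! ### The two-scale digit weight -/

/-- The weight of a monomial for a character factoring through a map `g` on the cells is read off
its `g`-margins. [folklore] -/
theorem weight_comp_eq_sum_mapDomain {ι : Type*} [Fintype ι] (g : Fin n × Fin n → ι) (u : ι → ℕ)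
    (d : (Fin n × Fin n) →₀ ℕ) :
    Finsupp.weight (fun v => u (g v)) d = ∑ k, Finsupp.mapDomain g d k * u k := by
  rw [← Finsupp.sum_fintype (Finsupp.mapDomain g d) (fun k c => c * u k) fun _ => zero_mul _,
    Finsupp.sum_mapDomain_index (fun _ => zero_mul _) fun _ _ _ => add_mul _ _ _,
    Finsupp.weight_apply]
  simp only [smul_eq_mul]

/-- **The two-scale digit weight.**  For the character `x_{(i,j)} ↦ B^i + B^{n+j}` a monomial
weighs the base-`B` numeral whose digits (indexed by `Fin (n + n)`) are its row margins followed
by its column margins. [folklore] -/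
theorem weight_twoScale (B : ℕ) (d : (Fin n × Fin n) →₀ ℕ) :
    Finsupp.weight (fun e : Fin n × Fin n => B ^ (e.1 : ℕ) + B ^ (n + (e.2 : ℕ))) d =
      ∑ k : Fin (n + n),
        Fin.append (⇑(Finsupp.mapDomain Prod.fst d)) (⇑(Finsupp.mapDomain Prod.snd d)) k *
          B ^ (k : ℕ) := by
  have h1 := weight_comp_eq_sum_mapDomain Prod.fst (fun i : Fin n => B ^ (i : ℕ)) d
  have h2 := weight_comp_eq_sum_mapDomain Prod.snd (fun j : Fin n => B ^ (n + (j : ℕ))) d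
  rw [Fin.sum_univ_add]
  simp only [Fin.append_left, Fin.append_right, Fin.val_castAdd, Fin.val_natAdd]
  rw [← h1, ← h2]
  simp only [Finsupp.weight_apply, smul_eq_mul, mul_add, Finsupp.sum_add]

/-- **Equal top weight forces equal margins.**  For `f` of total degree `≤ D`, two monomials of
the top component of `f` for the two-scale digit weight of radix `D + 1` have the same row margins
and the same column margins (base-`D + 1` uniqueness of digit vectors). [folklore] -/
theorem margins_eq_of_mem_support_topComponent_twoScale {D : ℕ}
    {f : MvPolynomial (Fin n × Fin n) ℝ≥0} (hf : f.totalDegree ≤ D)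
    {m m' : (Fin n × Fin n) →₀ ℕ}
    (hm : m ∈ (topComponent
      (fun e : Fin n × Fin n => (D + 1) ^ (e.1 : ℕ) + (D + 1) ^ (n + (e.2 : ℕ))) f).support)
    (hm' : m' ∈ (topComponent
      (fun e : Fin n × Fin n => (D + 1) ^ (e.1 : ℕ) + (D + 1) ^ (n + (e.2 : ℕ))) f).support) :
    Finsupp.mapDomain Prod.fst m = Finsupp.mapDomain Prod.fst m' ∧
      Finsupp.mapDomain Prod.snd m = Finsupp.mapDomain Prod.snd m' := by
  set B := D + 1 with hB
  set W : Fin n × Fin n → ℕ := fun e => B ^ (e.1 : ℕ) + B ^ (n + (e.2 : ℕ)) with hW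
  have hw : ∀ e ∈ (topComponent W f).support, Finsupp.weight W e = weightedTotalDegree W f := by
    intro e he
    have := mem_support_iff.mp he
    rw [coeff_topComponent] at this
    by_contra hne
    exact this (if_neg hne)
  have hlt : ∀ e ∈ (topComponent W f).support, ∀ k : Fin (n + n),
      Fin.append (⇑(Finsupp.mapDomain Prod.fst e)) (⇑(Finsupp.mapDomain Prod.snd e)) k < B := by
    intro e he k
    refine Fin.addCases (fun i => ?_) (fun j => ?_) k
    · rw [Fin.append_left]
      exact Nat.lt_succ_of_le ((mapDomain_apply_le_totalDegree Prod.fst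
        (support_topComponent_subset _ f he) i).trans hf)
    · rw [Fin.append_right]
      exact Nat.lt_succ_of_le ((mapDomain_apply_le_totalDegree Prod.snd
        (support_topComponent_subset _ f he) j).trans hf)
  have key := eq_of_sum_mul_pow_eq _ _ (hlt m hm) (hlt m' hm')
    (by rw [← weight_twoScale, ← weight_twoScale, hw m hm, hw m' hm'])
  refine ⟨Finsupp.ext fun i => ?_, Finsupp.ext fun j => ?_⟩
  · simpa only [Fin.append_left] using congrFun key (Fin.castAdd n i)
  · simpa only [Fin.append_right] using congrFun key (Fin.natAdd n j)

/-! ### Row-local and column-local monomials are read off their margins -/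

/-- A monomial living in row `r` has `m (r, j)` as its `j`-th column margin. [folklore] -/
theorem apply_eq_mapDomain_snd_of_row {r : Fin n} {m : (Fin n × Fin n) →₀ ℕ}
    (hr : ∀ e ∈ m.support, e.1 = r) (j : Fin n) :
    m (r, j) = Finsupp.mapDomain Prod.snd m j := by
  symm
  exact Finsupp.mapDomain_apply' {e : Fin n × Fin n | e.1 = r} m (fun e he => hr e he)
    (fun a ha b hb h => Prod.ext (ha.trans hb.symm) h) (a := (r, j)) rfl

/-- A monomial living in column `s` has `m (i, s)` as its `i`-th row margin. [folklore] -/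
theorem apply_eq_mapDomain_fst_of_col {s : Fin n} {m : (Fin n × Fin n) →₀ ℕ}
    (hs : ∀ e ∈ m.support, e.2 = s) (i : Fin n) :
    m (i, s) = Finsupp.mapDomain Prod.fst m i := by
  symm
  exact Finsupp.mapDomain_apply' {e : Fin n × Fin n | e.2 = s} m (fun e he => hs e he)
    (fun a ha b hb h => Prod.ext h (ha.trans hb.symm)) (a := (i, s)) rfl

/-- Two monomials living in the same row with the same column margins are equal. [folklore] -/
theorem eq_of_row_of_mapDomain_snd_eq {r : Fin n} {m m' : (Fin n × Fin n) →₀ ℕ}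
    (hm : ∀ e ∈ m.support, e.1 = r) (hm' : ∀ e ∈ m'.support, e.1 = r)
    (h : Finsupp.mapDomain Prod.snd m = Finsupp.mapDomain Prod.snd m') : m = m' := by
  refine Finsupp.ext fun e => ?_
  obtain ⟨i, j⟩ := e
  by_cases hi : i = r
  · subst hi
    rw [apply_eq_mapDomain_snd_of_row hm, apply_eq_mapDomain_snd_of_row hm', h]
  · have h1 : m (i, j) = 0 := Finsupp.notMem_support_iff.mp fun he => hi (hm _ he)
    have h2 : m' (i, j) = 0 := Finsupp.notMem_support_iff.mp fun he => hi (hm' _ he)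
    rw [h1, h2]

/-- Two monomials living in the same column with the same row margins are equal. [folklore] -/
theorem eq_of_col_of_mapDomain_fst_eq {s : Fin n} {m m' : (Fin n × Fin n) →₀ ℕ}
    (hm : ∀ e ∈ m.support, e.2 = s) (hm' : ∀ e ∈ m'.support, e.2 = s)
    (h : Finsupp.mapDomain Prod.fst m = Finsupp.mapDomain Prod.fst m') : m = m' := by
  refine Finsupp.ext fun e => ?_
  obtain ⟨i, j⟩ := e
  by_cases hj : j = s
  · subst hj
    rw [apply_eq_mapDomain_fst_of_col hm, apply_eq_mapDomain_fst_of_col hm', h]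
  · have h1 : m (i, j) = 0 := Finsupp.notMem_support_iff.mp fun he => hj (hm _ he)
    have h2 : m' (i, j) = 0 := Finsupp.notMem_support_iff.mp fun he => hj (hm' _ he)
    rw [h1, h2]

/-! ### The stub -/

/-- **`stub_localUniqueTop` (line `pair-descent-jss-endpoint` for `PerDivisionHard`, v15).**  Under
the TWO-SCALE DIGIT character `w(i,j) = (D+1)^i + (D+1)^{n+j}` every polynomial of total degree
`≤ D` all of whose monomials live in ONE ROW (resp. ONE COLUMN) is topped by at most one monomial:
two monomials of the top component have equal weights, hence (base-`D + 1` uniqueness,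
`eq_of_sum_mul_pow_eq`) equal row margins and equal column margins, and a row-local
(column-local) monomial is determined by its column (row) margins. [folklore] -/
theorem stub_localUniqueTop :
    ∀ (n D : ℕ) (f : MvPolynomial (Fin n × Fin n) ℝ≥0), f.totalDegree ≤ D →
      ((∃ r : Fin n, ∀ m ∈ f.support, ∀ e ∈ m.support, e.1 = r) ∨
        (∃ s : Fin n, ∀ m ∈ f.support, ∀ e ∈ m.support, e.2 = s)) →
      (topComponent (fun e : Fin n × Fin n => (D + 1) ^ (e.1 : ℕ) + (D + 1) ^ (n + (e.2 : ℕ))) f).support.card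
        ≤ 1 := by
  intro n D f hf hloc
  refine Finset.card_le_one.mpr fun m hm m' hm' => ?_
  obtain ⟨hrow, hcol⟩ := margins_eq_of_mem_support_topComponent_twoScale hf hm hm'
  have hmf : m ∈ f.support := support_topComponent_subset _ f hm
  have hm'f : m' ∈ f.support := support_topComponent_subset _ f hm'
  rcases hloc with ⟨r, hr⟩ | ⟨s, hs⟩
  · exact eq_of_row_of_mapDomain_snd_eq (hr m hmf) (hr m' hm'f) hcol
  · exact eq_of_col_of_mapDomain_fst_eq (hs m hmf) (hs m' hm'f) hrow

end Summit.ValiantsHypothesis.ValiantsHypothesis.Theorems.DivisionGapPerDivisionHard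

end
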